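import Summits.RiemannHypothesis.RiemannHypothesis.Theses.WeilComb
import Literature.NumberTheory.LFunctions.WeilExplicit
import Literature.NumberTheory.LFunctions.WeilArchimedeanMoments
import Literature.NumberTheory.LFunctions.WeilMellinBounds
import Literature.NumberTheory.LFunctions.WeilWindowSimpleEven
import Literature.NumberTheory.LFunctions.WeilMarkovQuadratic
import Literature.NumberTheory.LFunctions.WeilGroundEnergyProofs
import Literature.NumberTheory.LFunctions.MontgomeryOffDiagonalTools

/-!
# Stub `stub_poincare` of line `helson-dirichlet-slack` for crux `WeilComb.CombSubcritical`
(item stmt-RiemannHypothesis-1025, route route-RiemannHypothesis-WeilComb)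

The multiscale Hardy/Poincaré inequality on the von Mangoldt divisor graph (edges `m → nm`,
`n` a prime power, Perron gauge `n^{-1/2}`): top-heavy mass costs Dirichlet energy,

`Σ_{k ≤ M} k · log k · ‖a_k‖² ≤ 2M · D(a) + C · M · Σ_{m ≤ M} ‖a_m‖²`,
`D(a) = Σ_{m ≤ M} Σ_{n ≤ M/m} Λ(n) ‖a(nm) − n^{-1/2} a(m)‖²`,

with the absolute constant `C = 2 (log 4 + 4)` (twice Mathlib's Chebyshev constant).

Proof: write `log k = Σ_{n ∣ k} Λ(n)` (`ArithmeticFunction.vonMangoldt_sum`) and reindex the pairs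
`(k, n)`, `k ≤ M`, `n ∣ k` by `(m, n) = (k/n, n)`, `m ≤ M`, `n ≤ M/m` (a `Finset.sum_nbij'` between
sigma-finsets), so that `Σ_k k log k ‖a_k‖² = Σ_m Σ_{n ≤ M/m} Λ(n) (nm) ‖a(nm)‖²`. Along each edge,
`‖a(nm)‖² ≤ 2 ‖a(nm) − n^{-1/2} a(m)‖² + 2 ‖a(m)‖² / n` and `nm ≤ M`, whence
`Λ(n) (nm) ‖a(nm)‖² ≤ 2M Λ(n) ‖a(nm) − n^{-1/2} a(m)‖² + 2 m Λ(n) ‖a(m)‖²`. Summing, the first part is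
`2M · D(a)` and the second is `2 Σ_m m ‖a_m‖² ψ(M/m) ≤ 2 (log 4 + 4) Σ_m m (M/m) ‖a_m‖² ≤ C M ‖a‖²` by
Chebyshev's bound `ψ(x) ≤ (log 4 + 4) x` (`Montgomery.sum_Icc_vonMangoldt_le`, from Mathlib's
`Chebyshev.psi_le_const_mul_self`).
-/

noncomputable section

open scoped BigOperators ComplexConjugate
open Complex MeasureTheory Set

namespace Summit.RiemannHypothesis.RiemannHypothesis.Theorems.WeilCombSubcritical

open Literature.NumberTheory.LFunctions

/-- Reindexing the edges of the divisor graph by their endpoint: the pairs `(m, n)` with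
`1 ≤ m ≤ M`, `1 ≤ n ≤ M/m` correspond to the pairs `(k, n)` with `1 ≤ k ≤ M`, `n ∣ k` via `k = nm`,
so `Σ_{m ≤ M} Σ_{n ≤ M/m} F(n, m) = Σ_{k ≤ M} Σ_{n ∣ k} F(n, k/n)`. -/
private theorem sum_Icc_sum_Icc_div_eq_sum_divisors (M : ℕ) (F : ℕ → ℕ → ℝ) :
    ∑ m ∈ Finset.Icc 1 M, ∑ n ∈ Finset.Icc 1 (M / m), F n m =
      ∑ k ∈ Finset.Icc 1 M, ∑ n ∈ k.divisors, F n (k / n) := by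
  rw [Finset.sum_sigma', Finset.sum_sigma']
  refine Finset.sum_nbij' (fun x => ⟨x.2 * x.1, x.2⟩) (fun y => ⟨y.1 / y.2, y.2⟩) ?_ ?_ ?_ ?_ ?_
  · rintro ⟨m, n⟩ hx
    simp only [Finset.mem_sigma, Finset.mem_Icc] at hx
    obtain ⟨⟨hm1, -⟩, hn1, hnM⟩ := hx
    have hnm : 0 < n * m := Nat.mul_pos hn1 hm1
    simp only [Finset.mem_sigma, Finset.mem_Icc, Nat.mem_divisors]
    exact ⟨⟨hnm, (Nat.le_div_iff_mul_le hm1).1 hnM⟩, dvd_mul_right n m, hnm.ne'⟩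
  · rintro ⟨k, n⟩ hy
    simp only [Finset.mem_sigma, Finset.mem_Icc, Nat.mem_divisors] at hy
    obtain ⟨⟨hk1, hkM⟩, hnk, -⟩ := hy
    have hn0 : 0 < n := Nat.pos_of_dvd_of_pos hnk hk1
    have hkn : 0 < k / n := Nat.div_pos (Nat.le_of_dvd hk1 hnk) hn0
    simp only [Finset.mem_sigma, Finset.mem_Icc]
    refine ⟨⟨hkn, (Nat.div_le_self k n).trans hkM⟩, hn0, (Nat.le_div_iff_mul_le hkn).2 ?_⟩
    rw [Nat.mul_div_cancel' hnk]
    exact hkM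
  · rintro ⟨m, n⟩ hx
    simp only [Finset.mem_sigma, Finset.mem_Icc] at hx
    simp only [Nat.mul_div_cancel_left m hx.2.1]
  · rintro ⟨k, n⟩ hy
    simp only [Finset.mem_sigma, Nat.mem_divisors] at hy
    simp only [Nat.mul_div_cancel' hy.2.1]
  · rintro ⟨m, n⟩ hx
    simp only [Finset.mem_sigma, Finset.mem_Icc] at hx
    simp only [Nat.mul_div_cancel_left m hx.2.1]

/-- The elementary inequality `‖x‖² ≤ 2 ‖x − y‖² + 2 ‖y‖²` in `ℂ`. -/
private theorem norm_sq_le_two_mul_norm_sub_sq_add (x y : ℂ) :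
    ‖x‖ ^ 2 ≤ 2 * ‖x - y‖ ^ 2 + 2 * ‖y‖ ^ 2 := by
  have h : ‖x‖ ≤ ‖x - y‖ + ‖y‖ := by
    simpa only [sub_add_cancel] using norm_add_le (x - y) y
  nlinarith [sq_nonneg (‖x - y‖ - ‖y‖), norm_nonneg x, norm_nonneg (x - y), norm_nonneg y]

/-- The bound along one edge `m → nm` (`1 ≤ m`, `1 ≤ n`, `nm ≤ M`) of the divisor graph:
`Λ(n) (nm) ‖a(nm)‖² ≤ 2M Λ(n) ‖a(nm) − n^{-1/2} a(m)‖² + 2 m Λ(n) ‖a(m)‖²`. -/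
private theorem vonMangoldt_mul_mul_norm_sq_le (a : ℕ → ℂ) {M m n : ℕ} (hn : 1 ≤ n)
    (hnm : n * m ≤ M) :
    (ArithmeticFunction.vonMangoldt n : ℝ) * ((n * m : ℕ) : ℝ) * ‖a (n * m)‖ ^ 2 ≤
      2 * M * ((ArithmeticFunction.vonMangoldt n : ℝ) *
          ‖a (n * m) - ((Real.sqrt n : ℂ))⁻¹ * a m‖ ^ 2) +
        2 * ((ArithmeticFunction.vonMangoldt n : ℝ) * ((m : ℝ) * ‖a m‖ ^ 2)) := by
  have hn' : (0 : ℝ) < n := by exact_mod_cast hn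
  have hnmM : ((n * m : ℕ) : ℝ) ≤ M := by exact_mod_cast hnm
  have hΛ : 0 ≤ (ArithmeticFunction.vonMangoldt n : ℝ) := ArithmeticFunction.vonMangoldt_nonneg
  have hy : ‖((Real.sqrt n : ℂ))⁻¹ * a m‖ ^ 2 = ‖a m‖ ^ 2 / n := by
    rw [norm_mul, norm_inv, Complex.norm_real, Real.norm_of_nonneg (Real.sqrt_nonneg _), mul_pow,
      inv_pow, Real.sq_sqrt hn'.le]
    ring
  have hpar := norm_sq_le_two_mul_norm_sub_sq_add (a (n * m)) (((Real.sqrt n : ℂ))⁻¹ * a m)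
  rw [hy] at hpar
  have hD : 0 ≤ (ArithmeticFunction.vonMangoldt n : ℝ) *
      ‖a (n * m) - ((Real.sqrt n : ℂ))⁻¹ * a m‖ ^ 2 := by positivity
  calc (ArithmeticFunction.vonMangoldt n : ℝ) * ((n * m : ℕ) : ℝ) * ‖a (n * m)‖ ^ 2
      ≤ (ArithmeticFunction.vonMangoldt n : ℝ) * ((n * m : ℕ) : ℝ) *
          (2 * ‖a (n * m) - ((Real.sqrt n : ℂ))⁻¹ * a m‖ ^ 2 + 2 * (‖a m‖ ^ 2 / n)) :=
        mul_le_mul_of_nonneg_left hpar (by positivity)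
    _ = 2 * ((n * m : ℕ) : ℝ) * ((ArithmeticFunction.vonMangoldt n : ℝ) *
          ‖a (n * m) - ((Real.sqrt n : ℂ))⁻¹ * a m‖ ^ 2) +
        2 * ((ArithmeticFunction.vonMangoldt n : ℝ) * ((m : ℝ) * ‖a m‖ ^ 2)) := by
        push_cast
        field_simp
    _ ≤ 2 * M * ((ArithmeticFunction.vonMangoldt n : ℝ) *
          ‖a (n * m) - ((Real.sqrt n : ℂ))⁻¹ * a m‖ ^ 2) +
        2 * ((ArithmeticFunction.vonMangoldt n : ℝ) * ((m : ℝ) * ‖a m‖ ^ 2)) := by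
        gcongr

/-- **Stub 2 — multiscale Hardy/Poincaré inequality on the divisor graph.**
`∃ C, ∀ M a, Σ_{m ≤ M} m·log m·‖a_m‖² ≤ 2M·D(a) + C·M·‖a‖²`. -/
theorem stub_poincare :
    ∃ C : ℝ, ∀ (M : ℕ) (a : ℕ → ℂ),
      ∑ m ∈ Finset.Icc 1 M, (m : ℝ) * Real.log m * ‖a m‖ ^ 2 ≤
        2 * M * (∑ m ∈ Finset.Icc 1 M, ∑ n ∈ Finset.Icc 1 (M / m),
            (ArithmeticFunction.vonMangoldt n : ℝ) * ‖a (n * m) - ((Real.sqrt n : ℂ))⁻¹ * a m‖ ^ 2) +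
          C * M * ∑ m ∈ Finset.Icc 1 M, ‖a m‖ ^ 2 := by
  refine ⟨2 * (Real.log 4 + 4), fun M a => ?_⟩
  -- Step 1: `Σ_k k log k ‖a_k‖² = Σ_m Σ_{n ≤ M/m} Λ(n) (nm) ‖a(nm)‖²`.
  have h1 : ∑ m ∈ Finset.Icc 1 M, (m : ℝ) * Real.log m * ‖a m‖ ^ 2 =
      ∑ m ∈ Finset.Icc 1 M, ∑ n ∈ Finset.Icc 1 (M / m),
        (ArithmeticFunction.vonMangoldt n : ℝ) * ((n * m : ℕ) : ℝ) * ‖a (n * m)‖ ^ 2 := by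
    rw [sum_Icc_sum_Icc_div_eq_sum_divisors M
      (fun n m => (ArithmeticFunction.vonMangoldt n : ℝ) * ((n * m : ℕ) : ℝ) * ‖a (n * m)‖ ^ 2)]
    refine Finset.sum_congr rfl fun k _ => ?_
    rw [← ArithmeticFunction.vonMangoldt_sum, Finset.mul_sum, Finset.sum_mul]
    refine Finset.sum_congr rfl fun n hn => ?_
    rw [Nat.mul_div_cancel' (Nat.mem_divisors.1 hn).1]
    ring
  -- Step 2: the edgewise bound, summed over all edges.
  have h2 : ∑ m ∈ Finset.Icc 1 M, ∑ n ∈ Finset.Icc 1 (M / m),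
      (ArithmeticFunction.vonMangoldt n : ℝ) * ((n * m : ℕ) : ℝ) * ‖a (n * m)‖ ^ 2 ≤
      ∑ m ∈ Finset.Icc 1 M, ∑ n ∈ Finset.Icc 1 (M / m),
        (2 * M * ((ArithmeticFunction.vonMangoldt n : ℝ) *
            ‖a (n * m) - ((Real.sqrt n : ℂ))⁻¹ * a m‖ ^ 2) +
          2 * ((ArithmeticFunction.vonMangoldt n : ℝ) * ((m : ℝ) * ‖a m‖ ^ 2))) := by
    refine Finset.sum_le_sum fun m hm => Finset.sum_le_sum fun n hn => ?_
    have hm1 : 1 ≤ m := (Finset.mem_Icc.1 hm).1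
    obtain ⟨hn1, hnM⟩ := Finset.mem_Icc.1 hn
    exact vonMangoldt_mul_mul_norm_sq_le a hn1 ((Nat.le_div_iff_mul_le hm1).1 hnM)
  -- Step 3: split the summed bound into `2M · D(a)` and `2 Σ_m m ‖a_m‖² ψ(M/m)`.
  have h3 : ∑ m ∈ Finset.Icc 1 M, ∑ n ∈ Finset.Icc 1 (M / m),
      (2 * M * ((ArithmeticFunction.vonMangoldt n : ℝ) *
          ‖a (n * m) - ((Real.sqrt n : ℂ))⁻¹ * a m‖ ^ 2) +
        2 * ((ArithmeticFunction.vonMangoldt n : ℝ) * ((m : ℝ) * ‖a m‖ ^ 2))) =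
      2 * M * (∑ m ∈ Finset.Icc 1 M, ∑ n ∈ Finset.Icc 1 (M / m),
          (ArithmeticFunction.vonMangoldt n : ℝ) * ‖a (n * m) - ((Real.sqrt n : ℂ))⁻¹ * a m‖ ^ 2) +
        2 * ∑ m ∈ Finset.Icc 1 M, (m : ℝ) * ‖a m‖ ^ 2 *
          ∑ n ∈ Finset.Icc 1 (M / m), (ArithmeticFunction.vonMangoldt n : ℝ) := by
    rw [Finset.mul_sum, Finset.mul_sum, ← Finset.sum_add_distrib]
    refine Finset.sum_congr rfl fun m _ => ?_
    rw [Finset.sum_add_distrib]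
    simp only [Finset.mul_sum]
    congr 1
    refine Finset.sum_congr rfl fun n _ => ?_
    ring
  -- Step 4: Chebyshev, `ψ(M/m) ≤ (log 4 + 4) (M/m)` and `m (M/m) ≤ M`.
  have h4 : ∑ m ∈ Finset.Icc 1 M, (m : ℝ) * ‖a m‖ ^ 2 *
      ∑ n ∈ Finset.Icc 1 (M / m), (ArithmeticFunction.vonMangoldt n : ℝ) ≤
      (Real.log 4 + 4) * M * ∑ m ∈ Finset.Icc 1 M, ‖a m‖ ^ 2 := by
    rw [Finset.mul_sum]
    refine Finset.sum_le_sum fun m _ => ?_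
    have hψ := Montgomery.sum_Icc_vonMangoldt_le (M / m)
    have hdiv : (m : ℝ) * ((M / m : ℕ) : ℝ) ≤ M := by exact_mod_cast Nat.mul_div_le M m
    have hlog : (0 : ℝ) ≤ Real.log 4 + 4 := by
      have := Real.log_nonneg (by norm_num : (1 : ℝ) ≤ 4)
      linarith
    calc (m : ℝ) * ‖a m‖ ^ 2 * ∑ n ∈ Finset.Icc 1 (M / m), (ArithmeticFunction.vonMangoldt n : ℝ)
        ≤ (m : ℝ) * ‖a m‖ ^ 2 * ((Real.log 4 + 4) * ((M / m : ℕ) : ℝ)) :=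
          mul_le_mul_of_nonneg_left hψ (by positivity)
      _ = (Real.log 4 + 4) * ((m : ℝ) * ((M / m : ℕ) : ℝ)) * ‖a m‖ ^ 2 := by ring
      _ ≤ (Real.log 4 + 4) * M * ‖a m‖ ^ 2 :=
          mul_le_mul_of_nonneg_right (mul_le_mul_of_nonneg_left hdiv hlog) (by positivity)
  rw [h1]
  refine h2.trans ?_
  rw [h3]
  linarith [h4]

end Summit.RiemannHypothesis.RiemannHypothesis.Theorems.WeilCombSubcritical

end
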